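import Literature.Computability.Complexity.Williams2014SatInstancePrelim
import HarnessLib

/-!
# Williams' Theorem 3.2: the SAT instance `D` as an explicit circuit

`Williams2014WitnessCheck.lean` proves that the `ACC`-SAT instance `D` of Williams 2014,
Thm. 3.2 (pp. 12–13: "`B` constructs an ACC CIRCUIT SAT instance `D` to verify that `W` is
correct … outputs `0` iff the variable assignment encoded by `W` satisfies the `i`th clause")
EXISTS (`exists_satInstance`, through the existential calculus `ACRealOver`/`ACVecOver`). The
verifier `B` (named fact `Williams2014_thm_3_2_machineB`, `Williams2014Lemma31.lean`) must
PRINT the code of `D` and hand it to the `ACC`-SAT algorithm, so its proof needs `D` as an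
explicit gate list whose specification is proved about that list. This file builds it with the
data-level combinators of `CircuitPlug.lean` / `Williams2014SatInstancePrelim.lean`, in the
shape a code-manipulating machine can reproduce by offset shifts:

1. `stG` — the clause circuits `G κ` side by side (`layerL`), in the order `coordOf`
   (slot-major; occupancy, polarity, index bits — the print order of `clauseCoordList`);
2. `st1–st3` — three copies of the witness circuit `W`, plugged with their inputs on the index
   wires of slots `0, 1, 2` (`plug`);
3. `st4–st6` — per slot the six gates of `addSlot` computing `p ∧ (a ↔ s)`;
4. `st7`, `st8` — a ternary disjunction and a (free) negation;

then `WitnessCheck.circuit G W` (extraction) and `WitnessCheck.satInstance G W m` (fan-in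
normalisation `Circuit.normFanIn`); everything of this file lives in the namespace
`WitnessCheck`. Proved: `circuit_eval_eq` (`= ¬ clauseCheck`), `circuit_acDepth_le`
(`≤ d_W + d_G + 4`), `circuit_size` (`Σ |G κ| + 3 |W| + 20`), `circuit_isOver`, and the
packaged `satInstance_spec`: over `accBasis m`, depth `≤ d_W + d_G + 4`, size
`≤ 3 (w + 2) s_G + 3 s_W + 20`, fan-in `≤ m (w + size)`, value
`¬ Clause.eval W.assignment (cl x i)`, and UNSATISFIABLE iff `W` encodes a satisfying
assignment of `succinctCNF c cl x` — the instance conditions of `AccSatInTime`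
(`Williams2014.lean`) and the correctness of `B` (p. 9: "`D` is an unsatisfiable circuit, if
and only if … `W` encod[es] a satisfying assignment").

## References

* R. Williams, *Nonuniform ACC circuit lower bounds*, J. ACM 61(1) (2014) 2:1–2:32, proof of
  Thm. 3.2 (pp. 12–13), §3 (p. 9) [Williams2014].
* H. Vollmer, *Introduction to Circuit Complexity*, Springer 1999, §1.2 [Vollmer1999].
-/

namespace Literature.Computability.Complexity

open GateList

namespace WitnessCheck

section SatInstance

variable {w : ℕ}
variable (G : ClauseCoord w → Circuit (Fin w)) (W : Circuit (Fin w))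

/-- **Stage 0**: the clause circuits side by side, in the order `coordOf` (slot-major, then
occupancy, polarity, index bits — the print order of `clauseCoordList`). [cite: Williams2014, proof of Thm. 3.2 (p. 12)] -/
def stG : List (Gate (Fin w)) × List (Fin w ⊕ ℕ) :=
  layerL (List.ofFn fun k : Fin (3 * (w + 2)) => G (coordOf k))

/-- The output wire of the clause circuit `G κ` in stage 0. [folklore] -/
def outG (κ : ClauseCoord w) : Fin w ⊕ ℕ :=
  (stG G).2[coordPos κ]'(by rw [stG, length_layerL_snd, List.length_ofFn]; exact coordPos_lt κ)

/-- The input wiring of the `ℓ`-th copy of `W`: the index bits of slot `ℓ`. [folklore] -/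
def ρW (ℓ : Fin 3) : Fin w → Fin w ⊕ ℕ := fun j => outG G (ℓ, Sum.inr j)

/-- **Stage 1**: the first copy of `W`. [cite: Williams2014, proof of Thm. 3.2 (p. 13)] -/
def st1 : List (Gate (Fin w)) × (Fin w ⊕ ℕ) := plug (stG G).1 (ρW G 0) W
/-- **Stage 2**: the second copy of `W`. [cite: Williams2014, proof of Thm. 3.2 (p. 13)] -/
def st2 : List (Gate (Fin w)) × (Fin w ⊕ ℕ) := plug (st1 G W).1 (ρW G 1) W
/-- **Stage 3**: the third copy of `W`. [cite: Williams2014, proof of Thm. 3.2 (p. 13)] -/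
def st3 : List (Gate (Fin w)) × (Fin w ⊕ ℕ) := plug (st2 G W).1 (ρW G 2) W

/-- The wires carrying the three witness values. [folklore] -/
def aW : Fin 3 → Fin w ⊕ ℕ := ![(st1 G W).2, (st2 G W).2, (st3 G W).2]

/-- **Stages 4–6**: the three slot tests. [cite: Williams2014, proof of Thm. 3.2 (p. 13)] -/
def st4 : List (Gate (Fin w)) × (Fin w ⊕ ℕ) :=
  addSlot (st3 G W).1 (aW G W 0) (outG G (0, Sum.inl true)) (outG G (0, Sum.inl false))
/-- Stage 5. [cite: Williams2014, proof of Thm. 3.2 (p. 13)] -/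
def st5 : List (Gate (Fin w)) × (Fin w ⊕ ℕ) :=
  addSlot (st4 G W).1 (aW G W 1) (outG G (1, Sum.inl true)) (outG G (1, Sum.inl false))
/-- Stage 6. [cite: Williams2014, proof of Thm. 3.2 (p. 13)] -/
def st6 : List (Gate (Fin w)) × (Fin w ⊕ ℕ) :=
  addSlot (st5 G W).1 (aW G W 2) (outG G (2, Sum.inl true)) (outG G (2, Sum.inl false))
/-- **Stage 7**: some slot is satisfied. [cite: Williams2014, proof of Thm. 3.2 (p. 13)] -/
def st7 : List (Gate (Fin w)) × (Fin w ⊕ ℕ) := or₃Wire (st6 G W).1 (st4 G W).2 (st5 G W).2 (st6 G W).2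
/-- **Stage 8**: the output — no slot is satisfied. [cite: Williams2014, proof of Thm. 3.2 (p. 13)] -/
def st8 : List (Gate (Fin w)) × (Fin w ⊕ ℕ) := notWire (st7 G W).1 (st7 G W).2

/-! #### The carried functions -/

/-- Occupancy bit of slot `ℓ`. [folklore] -/
def pF (ℓ : Fin 3) (x : Fin w → Bool) : Bool := (G (ℓ, Sum.inl false)).eval x
/-- Polarity bit of slot `ℓ`. [folklore] -/
def sF (ℓ : Fin 3) (x : Fin w → Bool) : Bool := (G (ℓ, Sum.inl true)).eval x
/-- Witness value of slot `ℓ`: `W` on the index bits. [folklore] -/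
def aF (ℓ : Fin 3) (x : Fin w → Bool) : Bool := W.eval fun j => (G (ℓ, Sum.inr j)).eval x
/-- Slot `ℓ` is satisfied. [folklore] -/
def litF (ℓ : Fin 3) (x : Fin w → Bool) : Bool := pF G ℓ x && decide (aF G W ℓ x = sF G ℓ x)

/-- The output function is `¬ clauseCheck`. [folklore] -/
theorem not_or_litF (x : Fin w → Bool) :
    (!(litF G W 0 x || litF G W 1 x || litF G W 2 x)) = !clauseCheck W.eval fun κ => (G κ).eval x := by
  congr 1
  rw [Bool.eq_iff_iff]
  simp only [litF, pF, sF, aF, clauseCheck, Fin.exists_fin_succ, Fin.exists_fin_zero, or_false,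
    Bool.or_eq_true, Bool.and_eq_true, decide_eq_true_eq, Fin.succ_zero_eq_one,
    Fin.succ_one_eq_two, or_assoc]

/-! #### Prefixes -/

/-- Each stage extends the previous program. [folklore] -/
theorem prefix_st1 : (stG G).1 <+: (st1 G W).1 := List.prefix_append _ _
/-- Each stage extends the previous program. [folklore] -/
theorem prefix_st2 : (st1 G W).1 <+: (st2 G W).1 := List.prefix_append _ _
/-- Each stage extends the previous program. [folklore] -/
theorem prefix_st3 : (st2 G W).1 <+: (st3 G W).1 := List.prefix_append _ _
/-- Each stage extends the previous program. [folklore] -/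
theorem prefix_st4 : (st3 G W).1 <+: (st4 G W).1 := prefix_addSlot _ _ _ _
/-- Each stage extends the previous program. [folklore] -/
theorem prefix_st5 : (st4 G W).1 <+: (st5 G W).1 := prefix_addSlot _ _ _ _
/-- Each stage extends the previous program. [folklore] -/
theorem prefix_st6 : (st5 G W).1 <+: (st6 G W).1 := prefix_addSlot _ _ _ _
/-- Each stage extends the previous program. [folklore] -/
theorem prefix_st7 : (st6 G W).1 <+: (st7 G W).1 := List.prefix_append _ _
/-- Each stage extends the previous program. [folklore] -/
theorem prefix_st8 : (st7 G W).1 <+: (st8 G W).1 := List.prefix_append _ _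

/-! #### What the wires carry -/

variable {dG dW : ℕ} (hG : ∀ κ, (G κ).acDepth ≤ dG) (hW : W.acDepth ≤ dW)
include hG

/-- In stage 0, `outG κ` carries `G κ`. [folklore] -/
theorem carries_outG (κ : ClauseCoord w) : Carries (stG G).1 (outG G κ) (G κ).eval dG := by
  have hk : coordPos κ < (List.ofFn fun k : Fin (3 * (w + 2)) => G (coordOf k)).length := by
    rw [List.length_ofFn]; exact coordPos_lt κ
  have e : (List.ofFn fun k : Fin (3 * (w + 2)) => G (coordOf k))[coordPos κ] = G κ := by
    rw [List.getElem_ofFn]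
    exact congrArg G (coordOf_coordPos κ)
  have h := carries_layerL (List.ofFn fun k : Fin (3 * (w + 2)) => G (coordOf k)) (coordPos κ) hk
    (d := dG) (by rw [e]; exact hG κ)
  rw [e] at h
  exact h

/-- In stage 3: the clause bits, at depth `d_G`. [folklore] -/
theorem carries_outG_st3 (κ : ClauseCoord w) : Carries (st3 G W).1 (outG G κ) (G κ).eval dG :=
  (((carries_outG G hG κ).of_prefix (prefix_st1 G W)).of_prefix (prefix_st2 G W)).of_prefix
    (prefix_st3 G W)

include hW

/-- In stage 3: the three witness values, at depth `d_W + d_G`. [folklore] -/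
theorem carries_aW (ℓ : Fin 3) : Carries (st3 G W).1 (aW G W ℓ) (aF G W ℓ) (dW + dG) := by
  have h0 : ∀ κ, Carries (stG G).1 (outG G κ) (G κ).eval dG := carries_outG G hG
  have h1 : ∀ κ, Carries (st1 G W).1 (outG G κ) (G κ).eval dG := fun κ => (h0 κ).of_prefix (prefix_st1 G W)
  have h2 : ∀ κ, Carries (st2 G W).1 (outG G κ) (G κ).eval dG := fun κ => (h1 κ).of_prefix (prefix_st2 G W)
  have c1 : Carries (st1 G W).1 (st1 G W).2 (aF G W 0) (dW + dG) :=
    (carries_plug W (f := fun j => (G (0, Sum.inr j)).eval) fun j => h0 (0, Sum.inr j)).mono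
      (Nat.add_le_add_right hW _)
  have c2 : Carries (st2 G W).1 (st2 G W).2 (aF G W 1) (dW + dG) :=
    (carries_plug W (f := fun j => (G (1, Sum.inr j)).eval) fun j => h1 (1, Sum.inr j)).mono
      (Nat.add_le_add_right hW _)
  have c3 : Carries (st3 G W).1 (st3 G W).2 (aF G W 2) (dW + dG) :=
    (carries_plug W (f := fun j => (G (2, Sum.inr j)).eval) fun j => h2 (2, Sum.inr j)).mono
      (Nat.add_le_add_right hW _)
  fin_cases ℓ
  · exact (c1.of_prefix (prefix_st2 G W)).of_prefix (prefix_st3 G W)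
  · exact c2.of_prefix (prefix_st3 G W)
  · exact c3

/-- In stage 6: the three slot tests, at depth `d_W + d_G + 3`. [folklore] -/
theorem carries_lit :
    Carries (st6 G W).1 (st4 G W).2 (litF G W 0) (dW + dG + 3) ∧
    Carries (st6 G W).1 (st5 G W).2 (litF G W 1) (dW + dG + 3) ∧
    Carries (st6 G W).1 (st6 G W).2 (litF G W 2) (dW + dG + 3) := by
  have ha := carries_aW G W hG hW
  have hs : ∀ ℓ : Fin 3, Carries (st3 G W).1 (outG G (ℓ, Sum.inl true)) (sF G ℓ) (dW + dG) :=
    fun ℓ => (carries_outG_st3 G W hG _).mono (Nat.le_add_left _ _)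
  have hp : ∀ ℓ : Fin 3, Carries (st3 G W).1 (outG G (ℓ, Sum.inl false)) (pF G ℓ) (dW + dG) :=
    fun ℓ => (carries_outG_st3 G W hG _).mono (Nat.le_add_left _ _)
  have l0 : Carries (st4 G W).1 (st4 G W).2 (litF G W 0) (dW + dG + 3) :=
    carries_addSlot (ha 0) (hs 0) (hp 0)
  have l1 : Carries (st5 G W).1 (st5 G W).2 (litF G W 1) (dW + dG + 3) :=
    carries_addSlot ((ha 1).of_prefix (prefix_st4 G W)) ((hs 1).of_prefix (prefix_st4 G W))
      ((hp 1).of_prefix (prefix_st4 G W))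
  have l2 : Carries (st6 G W).1 (st6 G W).2 (litF G W 2) (dW + dG + 3) :=
    carries_addSlot (((ha 2).of_prefix (prefix_st4 G W)).of_prefix (prefix_st5 G W))
      (((hs 2).of_prefix (prefix_st4 G W)).of_prefix (prefix_st5 G W))
      (((hp 2).of_prefix (prefix_st4 G W)).of_prefix (prefix_st5 G W))
  exact ⟨(l0.of_prefix (prefix_st5 G W)).of_prefix (prefix_st6 G W), l1.of_prefix (prefix_st6 G W), l2⟩

/-- In stage 8: the output wire carries `¬ clauseCheck`, at depth `d_W + d_G + 4`. [folklore] -/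
theorem carries_st8 : Carries (st8 G W).1 (st8 G W).2
    (fun x => !clauseCheck W.eval fun κ => (G κ).eval x) (dW + dG + 4) := by
  obtain ⟨l0, l1, l2⟩ := carries_lit G W hG hW
  have h7 := carries_or₃Wire l0 l1 l2
  exact (carries_notWire h7).congr fun x => not_or_litF G W x

omit hG hW

/-! #### Well-formedness, basis, size -/

/-- The final program is well formed. [folklore] -/
theorem wf_st8 : WF (st8 G W).1 := by
  have hG0 : ∀ κ, (G κ).acDepth ≤ (G κ).acDepth := fun _ => le_rfl
  -- out-of-range-free depth parameters: use each circuit's own depth via `Finset.sup`-free bounds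
  classical
  let dG := (Finset.univ : Finset (ClauseCoord w)).sup fun κ => (G κ).acDepth
  have hG : ∀ κ, (G κ).acDepth ≤ dG := fun κ => Finset.le_sup (f := fun κ => (G κ).acDepth) (Finset.mem_univ κ)
  have hW : W.acDepth ≤ W.acDepth := le_rfl
  have o0 : ∀ κ, OutOK (stG G).1.length (outG G κ) := fun κ => (carries_outG G hG κ).outOK
  have w0 : WF (stG G).1 := wf_layerL _
  have w1 : WF (st1 G W).1 := wf_plug w0 (fun j => o0 (0, Sum.inr j)) W
  have o1 : ∀ κ, OutOK (st1 G W).1.length (outG G κ) :=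
    fun κ => ((carries_outG G hG κ).of_prefix (prefix_st1 G W)).outOK
  have w2 : WF (st2 G W).1 := wf_plug w1 (fun j => o1 (1, Sum.inr j)) W
  have o2 : ∀ κ, OutOK (st2 G W).1.length (outG G κ) :=
    fun κ => (((carries_outG G hG κ).of_prefix (prefix_st1 G W)).of_prefix (prefix_st2 G W)).outOK
  have w3 : WF (st3 G W).1 := wf_plug w2 (fun j => o2 (2, Sum.inr j)) W
  have ha := carries_aW G W hG hW
  have hκ := carries_outG_st3 G W hG
  have w4 : WF (st4 G W).1 := wf_addSlot w3 (ha 0).outOK (hκ _).outOK (hκ _).outOK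
  have w5 : WF (st5 G W).1 := wf_addSlot w4 ((ha 1).of_prefix (prefix_st4 G W)).outOK
    ((hκ _).of_prefix (prefix_st4 G W)).outOK ((hκ _).of_prefix (prefix_st4 G W)).outOK
  have w6 : WF (st6 G W).1 := wf_addSlot w5
    (((ha 2).of_prefix (prefix_st4 G W)).of_prefix (prefix_st5 G W)).outOK
    (((hκ _).of_prefix (prefix_st4 G W)).of_prefix (prefix_st5 G W)).outOK
    (((hκ _).of_prefix (prefix_st4 G W)).of_prefix (prefix_st5 G W)).outOK
  obtain ⟨l0, l1, l2⟩ := carries_lit G W hG hW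
  have w7 : WF (st7 G W).1 := wf_or₃Wire w6 l0.outOK l1.outOK l2.outOK
  exact wf_notWire w7 (carries_or₃Wire l0 l1 l2).outOK

/-- The final program is over any `B ⊇ acBasis` containing the gates of the `G κ` and of `W`.
[folklore] -/
theorem fn_mem_st8 {B : Set GateFn} (hB : acBasis ⊆ B) (hGB : ∀ κ, (G κ).IsOver B)
    (hWB : W.IsOver B) : ∀ g ∈ (st8 G W).1, g.fn ∈ B := by
  have h0 : ∀ g ∈ (stG G).1, g.fn ∈ B := fn_mem_layerL fun C hC => by
    obtain ⟨k, rfl⟩ := List.mem_ofFn.1 hC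
    exact hGB _
  have h3 : ∀ g ∈ (st3 G W).1, g.fn ∈ B :=
    fn_mem_plug (fn_mem_plug (fn_mem_plug h0 _ hWB) _ hWB) _ hWB
  have h6 : ∀ g ∈ (st6 G W).1, g.fn ∈ B :=
    fn_mem_addSlot hB (fn_mem_addSlot hB (fn_mem_addSlot hB h3 _ _ _) _ _ _) _ _ _
  exact fn_mem_notWire hB (fn_mem_or₃Wire hB h6 _ _ _) _

/-- The number of gates of stage 0: the clause circuits. [folklore] -/
theorem length_stG : (stG G).1.length = ∑ k : Fin (3 * (w + 2)), (G (coordOf k)).size := by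
  rw [stG, length_layerL_fst, List.map_ofFn, List.sum_ofFn]
  rfl

/-- The number of gates of stage 3: three copies of `W` more. [folklore] -/
theorem length_st3 : (st3 G W).1.length = (stG G).1.length + 3 * W.size := by
  have h1 : (st1 G W).1.length = (stG G).1.length + W.size := by rw [st1, length_plug]
  have h2 : (st2 G W).1.length = (st1 G W).1.length + W.size := by rw [st2, length_plug]
  have h3 : (st3 G W).1.length = (st2 G W).1.length + W.size := by rw [st3, length_plug]
  omega

/-- The number of gates: the clause circuits, three copies of `W`, twenty more. [folklore] -/
theorem length_st8 : (st8 G W).1.length =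
    (∑ k : Fin (3 * (w + 2)), (G (coordOf k)).size) + 3 * W.size + 20 := by
  have h4 : (st4 G W).1.length = (st3 G W).1.length + 6 := by rw [st4, length_addSlot]
  have h5 : (st5 G W).1.length = (st4 G W).1.length + 6 := by rw [st5, length_addSlot]
  have h6 : (st6 G W).1.length = (st5 G W).1.length + 6 := by rw [st6, length_addSlot]
  have h7 : (st7 G W).1.length = (st6 G W).1.length + 1 := by
    rw [st7, or₃Wire, List.length_append, List.length_singleton]
  have h8 : (st8 G W).1.length = (st7 G W).1.length + 1 := by rw [st8, length_notWire]
  rw [h8, h7, h6, h5, h4, length_st3, length_stG]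

/-! ### The circuit and its specification -/

/-- **The explicit witness-check circuit** (the instance `D` of Williams 2014, Thm. 3.2,
before fan-in normalisation). [cite: Williams2014, proof of Thm. 3.2 (pp. 12–13)] -/
noncomputable def circuit : Circuit (Fin w) :=
  GateList.toCircuit (st8 G W).1 (st8 G W).2 (wf_st8 G W) (by
    classical
    exact (carries_st8 G W (dG := (Finset.univ : Finset (ClauseCoord w)).sup fun κ => (G κ).acDepth)
      (fun κ => Finset.le_sup (f := fun κ => (G κ).acDepth) (Finset.mem_univ κ)) le_rfl).outOK)

/-- **Semantics**: `D(i) = ¬ clauseCheck`. [cite: Williams2014, proof of Thm. 3.2 (p. 13)] -/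
theorem circuit_eval_eq (x : Fin w → Bool) :
    (circuit G W).eval x = !clauseCheck W.eval fun κ => (G κ).eval x := by
  classical
  rw [circuit, circuit_eval]
  exact (carries_st8 G W (dG := (Finset.univ : Finset (ClauseCoord w)).sup fun κ => (G κ).acDepth)
    (fun κ => Finset.le_sup (f := fun κ => (G κ).acDepth) (Finset.mem_univ κ)) le_rfl).eval x

/-- **Depth**: `≤ d_W + d_G + 4`. [cite: Williams2014, proof of Thm. 3.2 (p. 13)] -/
theorem circuit_acDepth_le {dG dW : ℕ} (hG : ∀ κ, (G κ).acDepth ≤ dG)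
    (hW : W.acDepth ≤ dW) : (circuit G W).acDepth ≤ dW + dG + 4 := by
  change Circuit.depthWith _ acWeight ≤ _
  rw [circuit, circuit_depthWith]
  exact (carries_st8 G W hG hW).depth

/-- **Size**: `Σ |G κ| + 3 |W| + 20` gates. [cite: Williams2014, proof of Thm. 3.2 (p. 13)] -/
theorem circuit_size : (circuit G W).size =
    (∑ k : Fin (3 * (w + 2)), (G (coordOf k)).size) + 3 * W.size + 20 :=
  length_st8 G W

/-- **Basis**: over `B ⊇ acBasis` when the parts are. [folklore] -/
theorem circuit_isOver {B : Set GateFn} (hB : acBasis ⊆ B) (hGB : ∀ κ, (G κ).IsOver B)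
    (hWB : W.IsOver B) : (circuit G W).IsOver B :=
  fn_mem_st8 G W hB hGB hWB

/-- **The explicit `ACC`-SAT instance `D`** of Williams 2014, Thm. 3.2: the witness-check
circuit with its fan-in normalised (`Circuit.normFanIn`). [cite: Williams2014, proof of Thm. 3.2 (pp. 12–13)] -/
noncomputable def satInstance (m : ℕ) : Circuit (Fin w) := (circuit G W).normFanIn m

end SatInstance

/-- **Specification of the explicit instance** (everything the verifier `B` needs): for a
succinct reduction `cl` of `L` (constant `c`), input `x`, width `w = succinctWidth c |x|`,
clause circuits `G κ` over `accBasis m` (`0 < m`) of depth `≤ d_G` and size `≤ s_G` computing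
the clause map of `cl x`, and a witness circuit `W` on `w` inputs over `accBasis m` of depth
`≤ d_W` and size `≤ s_W`, the circuit `satInstance G W m` is over `accBasis m`, has
`acDepth ≤ d_W + d_G + 4`, at most `3 (w + 2) s_G + 3 s_W + 20` gates, fan-in at most
`m (w + size)`, and is UNSATISFIABLE iff `W` encodes a satisfying assignment of
`succinctCNF c cl x` (Williams 2014, p. 13: "`D` has `O(n S(2n) + S(3n))` size, depth
`2d + O(1)`, and `n + c log n` inputs"; p. 9: "`D` is an unsatisfiable circuit, if and only if
… `W` encod[es] a satisfying assignment"). [cite: Williams2014, proof of Thm. 3.2 (pp. 12–13)] -/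
theorem satInstance_spec {c m : ℕ} (hm : 0 < m) {L : Language Bool}
    {cl : List Bool → ℕ → Clause ℕ} (hred : IsSuccinctReduction c L cl) (x : List Bool)
    {dG sG dW sW : ℕ}
    (G : ClauseCoord (succinctWidth c x.length) → Circuit (Fin (succinctWidth c x.length)))
    (hGB : ∀ κ, (G κ).IsOver (accBasis m)) (hGd : ∀ κ, (G κ).acDepth ≤ dG)
    (hGs : ∀ κ, (G κ).size ≤ sG)
    (hGe : ∀ κ i, (G κ).eval i = clauseMap (succinctWidth c x.length) (cl x) i κ)
    (W : Circuit (Fin (succinctWidth c x.length))) (hWB : W.IsOver (accBasis m))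
    (hWd : W.acDepth ≤ dW) (hWs : W.size ≤ sW) :
    (satInstance G W m).IsOver (accBasis m) ∧
    (satInstance G W m).acDepth ≤ dW + dG + 4 ∧
    (satInstance G W m).size ≤ 3 * (succinctWidth c x.length + 2) * sG + 3 * sW + 20 ∧
    (satInstance G W m).maxFanIn ≤
      m * (succinctWidth c x.length + (satInstance G W m).size) ∧
    (∀ i, (satInstance G W m).eval i = !(Clause.eval W.assignment (cl x (bitsVal i)))) ∧
    (¬ (satInstance G W m).Satisfiable ↔ (succinctCNF c cl x).eval W.assignment = true) := by
  have hO : (circuit G W).IsOver (accBasis m) :=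
    circuit_isOver G W (acBasis_subset_accBasis m) hGB hWB
  have hev : ∀ i, (satInstance G W m).eval i = !(Clause.eval W.assignment (cl x (bitsVal i))) := by
    intro i
    rw [satInstance, Circuit.eval_normFanIn, circuit_eval_eq]
    have hGi : (fun κ => (G κ).eval i) = clauseMap (succinctWidth c x.length) (cl x) i :=
      funext fun κ => hGe κ i
    rw [hGi, clauseMap, clauseCheck_clauseBit W (hred.length_le x _) (hred.var_lt x _)]
  refine ⟨Circuit.isOver_normFanIn hO, ?_, ?_, ?_, hev, ?_⟩
  · exact (Circuit.acDepth_normFanIn_le m _).trans (circuit_acDepth_le G W hGd hWd)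
  · rw [satInstance, Circuit.size_normFanIn, circuit_size]
    have h1 : (∑ k : Fin (3 * (succinctWidth c x.length + 2)), (G (coordOf k)).size) ≤
        3 * (succinctWidth c x.length + 2) * sG := by
      refine (Finset.sum_le_card_nsmul _ _ sG fun k _ => hGs _).trans ?_
      simp
    have h2 : 3 * W.size ≤ 3 * sW := Nat.mul_le_mul_left 3 hWs
    omega
  · simpa [satInstance] using Circuit.maxFanIn_normFanIn_le hm hO
  · constructor
    · intro h
      rw [eval_succinctCNF_eq_true_iff]
      intro v hv
      by_contra hne
      refine h ⟨(MetaComplexity.boolFunEquivFin _).symm ⟨v, hv⟩, ?_⟩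
      rw [hev, bitsVal_symm_apply hv]
      simpa using hne
    · rintro h ⟨i, hi⟩
      rw [eval_succinctCNF_eq_true_iff] at h
      rw [hev, h _ (bitsVal_lt i)] at hi
      simp at hi

end WitnessCheck

end Literature.Computability.Complexity
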